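import Summits.BirchSwinnertonDyer.BirchSwinnertonDyer.Theorems.SchneiderFreeAdditiveX3UpperReceptacle
import Summits.BirchSwinnertonDyer.BirchSwinnertonDyer.Theorems.SchneiderFreeAdditiveX3LogOmegaConjugatePrime
import HarnessLib

/-!
# The EXACT Heegner index at the Manin slack from an EQUALITY-grade anticyclotomic frame
# (route-free; the middle step of the W-ALL kernel `ToricKernelAtThree`, stmt-BirchSwinnertonDyer-20390)

Seat `bsd-potss-kmc`, gen 18 (cell `bsd-potss`; kernel service on bsd-wall-pss3's route
`UniversalToricDescent`). ROUTE-FREE (imports no `Theses.*`): the receptacle currency is K1's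
(`SchneiderFree.AdditiveIMCLowerBDPOnTreeLeAt` / `SchneiderFree.Upper.AdditiveIMCUpperBDPOnTreeLeAt`,
`SchneiderFree.AdditiveControlOnTreeAt`, `SchneiderFree.IndexLowerBoundLeAt` /
`SchneiderFree.Upper.IndexUpperBoundLeAt`), which carries NO reduction-type hypothesis, so the same
lemmas serve a potentially supersingular additive prime.

* §1 `exists_two_degreeOnePrimes_of_splitsIn` — for `[K:ℚ] = 2` and `p` split in `K`
  (`X11b.SplitsIn K p`: two primes over `(p)`), TWO DISTINCT primes `𝔭 ≠ 𝔭′` of `𝓞 K` above `p`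
  exist and both have `e = f = 1` (tree `placesOver_trichotomy_of_finrank_eq_two`).
* §2 `additiveIMCLowerBDPOnTreeLeAt_of_value_of_eq`, `additiveIMC_lower_and_upper_of_value_of_eq` —
  the EXACT receptacle at one frame: CTL₀ (`XAc.HasCharValuationAt … n`) ∧ the EQUALITY
  `Ch_Λ(X_ac)·R₀⟦T⟧ = (L)` ∧ the value `L(𝟙) = u·(log_{ω_E} P / c)²` with `u` a UNIT of `R₀` ⟹ BOTH
  sockets at slack `v_p(c)`, i.e. `n + 2·v_p(c) = 2·ord_p log_{ω_E} P`; `log_{ω_E} P ≠ 0` and `c ≠ 0`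
  come OUT of the lower half (`Supersingular.two_mul_valuation_le_of_mem_span`) and feed the upper
  half (`SchneiderFree.Upper.additiveIMCUpperBDPOnTreeLeAt_of_value_of_dvd'`).
* §3 `exactIndex_of_equality_of_value_of_control` — at one Heegner datum over a classical Heegner
  field `K` (rank `E(K) = 1`, `Ш(E/K)` finite) and two degree-one primes `𝔭, 𝔭′` above the split `p`:
  the equality for the module STRICT AT `𝔭′` + the value with the logarithm read AT `𝔭` (K1's
  `hasValueAt_sq_logOmega_embAt_iff_of_rank_one` moves it to `𝔭′`: `(log_{𝔭′} P)² = (log_𝔭 P)²` in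
  rank one) + the control equality at `𝔭′` ⟹ the EXACT index at slack `v_p(c)`:
  `SchneiderFree.IndexLowerBoundLeAt W p K P (v_p c) ∧ SchneiderFree.Upper.IndexUpperBoundLeAt W p K P (v_p c)`
  (`2·v_p[E(K):ℤP] = v_p #Ш(E/K) + 2·v_p ∏ c_ℓ(E) + 2·v_p(c)`). This is the (𝔭, 𝔭′) = (frame
  prime, strict prime) layout of route UTD's cruxes 2–5 (tree ruling bsd-eis L31/L33, BED rev 8 R′).

HONEST FRAMING: `p`-adic norm algebra and bookkeeping over K1's currency; nothing asserted about
elliptic curves beyond the displayed hypotheses; no main conjecture, value formula or control theorem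
is proved here; BSD is not advanced by this file alone.

References: [JetchevSkinnerWan2017] §7.4.1 (arXiv:1512.06894 p. 30); [Castella2018] §5 (5.1)–(5.3)
(arXiv:1704.06608 p. 12); [LiuZhangZhang2018] Thm. 1.8; [FrohlichTaylor1990] III §1 (1.14)(a).
-/

noncomputable section

open scoped Classical

open WeierstrassCurve NumberField IsDedekindDomain Field PowerSeries
  Literature.NumberTheory.EllipticCurves
  Literature.NumberTheory.EllipticCurves.GreenbergSelmer
  Literature.NumberTheory.EllipticCurves.Rank1Residual
  Literature.NumberTheory.EllipticCurves.Rank1Residual.Typed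
  Summit.BirchSwinnertonDyer.Rank1Residual
  Summit.BirchSwinnertonDyer.Rank1Residual.X11b
  Summit.BirchSwinnertonDyer.Rank1Residual.X11b.AcSelmer
  Summit.BirchSwinnertonDyer.Rank1Residual.X11b.Halves
  Summit.BirchSwinnertonDyer.Rank1Residual.X11b.CongruenceLimit

set_option linter.dupNamespace false
set_option autoImplicit false

namespace Summit.BirchSwinnertonDyer.BirchSwinnertonDyer.Theorems.SchneiderFree.Exact

/-! ### §1 Two distinct degree-one primes above a split prime of a quadratic field -/

section TwoPrimes

variable {K : Type} [Field K] [NumberField K] {p : ℕ} [Fact p.Prime]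

/-- **Two distinct degree-one primes above a split `p`.** For `[K:ℚ] = 2` and `p` split in `K`
(`X11b.SplitsIn K p`: exactly two primes of `𝓞 K` over `(p)`), there are primes `𝔭 ≠ 𝔭′` of `𝓞 K`
containing `p`, each with `e(𝔭|p) = f(𝔭|p) = 1` (the fundamental identity `Σ eᵢfᵢ = 2`; tree
`placesOver_trichotomy_of_finrank_eq_two`, `ncard_primesOver_span_eq`).
[cite: FrohlichTaylor1990, Ch. III §1 (1.14)(a)] -/
theorem exists_two_degreeOnePrimes_of_splitsIn (h2 : Module.finrank ℚ K = 2) (hs : SplitsIn K p) :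
    ∃ 𝔭 𝔭' : HeightOneSpectrum (𝓞 K), 𝔭' ≠ 𝔭 ∧
      ((p : ℕ) : 𝓞 K) ∈ 𝔭.asIdeal ∧ 𝔭.asIdeal.ramificationIdx (𝓞 ℚ) = 1 ∧
        𝔭.asIdeal.inertiaDeg (𝓞 ℚ) = 1 ∧
      ((p : ℕ) : 𝓞 K) ∈ 𝔭'.asIdeal ∧ 𝔭'.asIdeal.ramificationIdx (𝓞 ℚ) = 1 ∧
        𝔭'.asIdeal.inertiaDeg (𝓞 ℚ) = 1 := by
  have hcard : {w : HeightOneSpectrum (𝓞 K) | w.under (𝓞 ℚ) = ratPlace p}.ncard = 2 := by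
    rw [← ncard_primesOver_span_eq K (ratPlace p), primesEquiv_ratPlace]
    exact hs
  rcases placesOver_trichotomy_of_finrank_eq_two K h2 (ratPlace p) with
    ⟨w₁, w₂, hne, hset, hef⟩ | ⟨w, hset, -, -⟩ | ⟨w, hset, -, -⟩
  · have h1 : w₁.under (𝓞 ℚ) = ratPlace p := by
      have hw : w₁ ∈ {w : HeightOneSpectrum (𝓞 K) | w.under (𝓞 ℚ) = ratPlace p} := by
        rw [hset]; exact Set.mem_insert _ _
      exact hw
    have h2' : w₂.under (𝓞 ℚ) = ratPlace p := by
      have hw : w₂ ∈ {w : HeightOneSpectrum (𝓞 K) | w.under (𝓞 ℚ) = ratPlace p} := by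
        rw [hset]; exact Set.mem_insert_of_mem _ (Set.mem_singleton _)
      exact hw
    exact ⟨w₁, w₂, hne.symm, mem_of_under_eq_ratPlace h1, (hef w₁ h1).1, (hef w₁ h1).2,
      mem_of_under_eq_ratPlace h2', (hef w₂ h2').1, (hef w₂ h2').2⟩
  · rw [hset, Set.ncard_singleton] at hcard; exact absurd hcard (by norm_num)
  · rw [hset, Set.ncard_singleton] at hcard; exact absurd hcard (by norm_num)

end TwoPrimes

/-! ### §2 The EXACT receptacle at one frame (every `p`, every embedding, every `c`) -/

section Receptacle

variable {p : ℕ} [Fact p.Prime] {K : Type} [Field K] [NumberField K]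
  {W : WeierstrassCurve ℚ} [W.IsElliptic] [W.IsGloballyMinimal] {κ : ZpExtension K p}
  {𝔭 : HeightOneSpectrum (𝓞 K)} {γ : Field.absoluteGaloisGroup K} [Fact (κ.IsTopGenerator γ)]
  {ι : K →+* ℚ_[p]} {P : (W.baseChange K).toAffine.Point}

/-- **Lower socket from a one-sided divisibility and a UNIT-cofactor value, with the by-products
`log_{ω_E} P ≠ 0` and `c ≠ 0`.** CTL₀ (`HasCharValuationAt … n`) ∧ `Ch_Λ(X_ac)·R₀⟦T⟧ ⊆ (L)` ∧
`L(𝟙) = u·(log_{ω_E} P / c)²` with `u ∈ R₀^×` ⟹ `log_{ω_E} P ≠ 0`, `c ≠ 0`, and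
`SchneiderFree.AdditiveIMCLowerBDPOnTreeLeAt p κ 𝔭 γ ι (v_p c) P` (`2·ord_p log_{ω_E} P ≤ n + 2·v_p c`)
with the SAME `n`; norm algebra `Supersingular.two_mul_valuation_le_of_mem_span`.
[cite: Castella2018, §5 (5.1)–(5.3) (arXiv:1704.06608 p. 12)] [cite: JetchevSkinnerWan2017, §7.4.1 (arXiv:1512.06894 p. 30)] -/
theorem additiveIMCLowerBDPOnTreeLeAt_of_value_of_eq {n : ℕ}
    (hn : XAc.HasCharValuationAt (W.baseChange K) p κ 𝔭 ∅ γ n) {L : UnrSeries p}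
    (h3 : (XAc.charIdeal (W.baseChange K) p κ 𝔭 ∅ γ).map (PowerSeries.map (toUnr p)) ≤
      Ideal.span {L})
    (u : (unrIntegers p)ˣ) (c : ℤ)
    (h2 : L.HasValueAt 0 (((u : unrIntegers p) : ℂ_[p]) *
      (algebraMap ℚ_[p] ℂ_[p] (logOmega W p ι P / (c : ℚ_[p]))) ^ 2)) :
    logOmega W p ι P ≠ 0 ∧ c ≠ 0 ∧
      AdditiveIMCLowerBDPOnTreeLeAt p κ 𝔭 γ ι (padicValNat p c.natAbs) P := by
  obtain ⟨htors, f, hf, hf0, hfn⟩ := hn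
  have hmem : PowerSeries.map (toUnr p) f ∈ Ideal.span {L} := by
    rw [hf, map_span_singleton_powerSeries] at h3
    exact (Ideal.span_singleton_le_iff_mem _).mp h3
  obtain ⟨hy0, hle⟩ := Supersingular.two_mul_valuation_le_of_mem_span p hf0 hmem u h2
  have hlog : logOmega W p ι P ≠ 0 := by
    intro h; apply hy0; rw [h, zero_div]
  have hc0 : (c : ℚ_[p]) ≠ 0 := by
    intro h; apply hy0; rw [h, div_zero]
  have hc : c ≠ 0 := by
    intro h; apply hc0; rw [h, Int.cast_zero]
  rw [div_eq_mul_inv, Padic.valuation_mul hlog (inv_ne_zero hc0), Padic.valuation_inv,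
    Padic.valuation_intCast, valuation_logOmega hlog, hfn] at hle
  refine ⟨hlog, hc, n, ⟨htors, f, hf, hf0, hfn⟩, ?_⟩
  simp only [padicValInt] at hle
  linarith

/-- **The EXACT receptacle.** CTL₀ ∧ the EQUALITY `Ch_Λ(X_ac)·R₀⟦T⟧ = (L)` ∧ the value
`L(𝟙) = u·(log_{ω_E} P / c)²` with `u ∈ R₀^×` ⟹ BOTH sockets at slack `v_p(c)`:
`SchneiderFree.AdditiveIMCLowerBDPOnTreeLeAt … (v_p c) P ∧ SchneiderFree.Upper.AdditiveIMCUpperBDPOnTreeLeAt … (v_p c) P`,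
i.e. `n + 2·v_p(c) = 2·ord_p log_{ω_E} P`. [cite: JetchevSkinnerWan2017, §7.4.1 (arXiv:1512.06894 p. 30)]
[cite: Castella2018, §5 (5.1)–(5.3) (arXiv:1704.06608 p. 12)] -/
theorem additiveIMC_lower_and_upper_of_value_of_eq {n : ℕ}
    (hn : XAc.HasCharValuationAt (W.baseChange K) p κ 𝔭 ∅ γ n) {L : UnrSeries p}
    (h3 : (XAc.charIdeal (W.baseChange K) p κ 𝔭 ∅ γ).map (PowerSeries.map (toUnr p)) =
      Ideal.span {L})
    (u : (unrIntegers p)ˣ) (c : ℤ)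
    (h2 : L.HasValueAt 0 (((u : unrIntegers p) : ℂ_[p]) *
      (algebraMap ℚ_[p] ℂ_[p] (logOmega W p ι P / (c : ℚ_[p]))) ^ 2)) :
    AdditiveIMCLowerBDPOnTreeLeAt p κ 𝔭 γ ι (padicValNat p c.natAbs) P ∧
      Upper.AdditiveIMCUpperBDPOnTreeLeAt p κ 𝔭 γ ι (padicValNat p c.natAbs) P := by
  obtain ⟨hlog, hc, hlow⟩ := additiveIMCLowerBDPOnTreeLeAt_of_value_of_eq hn h3.le u c h2
  exact ⟨hlow, Upper.additiveIMCUpperBDPOnTreeLeAt_of_value_of_dvd' hn h3.ge u hc hlog h2⟩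

/-- Corollary: with the equality and the unit value, EVERY CTL₀ witness `n` satisfies
`n + 2·v_p(c) = 2·ord_p log_{ω_E} P`. [cite: JetchevSkinnerWan2017, §7.4.1 (arXiv:1512.06894 p. 30)] -/
theorem charValuation_add_eq_of_value_of_eq {n : ℕ}
    (hn : XAc.HasCharValuationAt (W.baseChange K) p κ 𝔭 ∅ γ n) {L : UnrSeries p}
    (h3 : (XAc.charIdeal (W.baseChange K) p κ 𝔭 ∅ γ).map (PowerSeries.map (toUnr p)) =
      Ideal.span {L})
    (u : (unrIntegers p)ˣ) (c : ℤ)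
    (h2 : L.HasValueAt 0 (((u : unrIntegers p) : ℂ_[p]) *
      (algebraMap ℚ_[p] ℂ_[p] (logOmega W p ι P / (c : ℚ_[p]))) ^ 2)) :
    (n : ℤ) + 2 * (padicValNat p c.natAbs : ℤ) = 2 * X11b.padicLogOrd W p ι P := by
  obtain ⟨⟨m, hm, hle⟩, ⟨m', hm', hle'⟩⟩ := additiveIMC_lower_and_upper_of_value_of_eq hn h3 u c h2
  obtain rfl : n = m := hn.unique hm
  obtain rfl : n = m' := hn.unique hm'
  omega

end Receptacle

/-! ### §3 At one Heegner datum: equality frame at `𝔭′` + value read at `𝔭` + control at `𝔭′` ⟹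
the EXACT index at the Manin slack -/

section Datum

variable {p : ℕ} [Fact p.Prime] {K : Type} [Field K] [NumberField K]
  {W : WeierstrassCurve ℚ} [W.IsElliptic] [W.IsGloballyMinimal] {N : ℕ} {κ : ZpExtension K p}
  {γ : Field.absoluteGaloisGroup K} [Fact (κ.IsTopGenerator γ)]
  {P : (W.baseChange K).toAffine.Point}

/-- **The exact index at slack `v_p(c)` from an equality-grade frame.** Over a classical Heegner
field `K` for `N_E` (`[K:ℚ] = 2`, every `ℓ ∣ N` split) with `rank E(K) = 1` and `Ш(E/K)` finite, let
`𝔭, 𝔭′` be degree-one primes above `p`. If the characteristic ideal of `X_ac(E/K_∞)` STRICT AT `𝔭′`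
base-changes to `(L)` in `R₀⟦T⟧` (EQUALITY), `L(𝟙) = u·(log_{ω_E,𝔭} P / c)²` with `u ∈ R₀^×` (the
logarithm read at `𝔭`), and the anticyclotomic control count holds at `𝔭′`
(`SchneiderFree.AdditiveControlOnTreeAt p κ 𝔭′ γ (embAt K p 𝔭′) P`), then
`SchneiderFree.IndexLowerBoundLeAt W p K P (v_p c) ∧ SchneiderFree.Upper.IndexUpperBoundLeAt W p K P (v_p c)`,
i.e. `2·v_p[E(K):ℤP] = v_p #Ш(E/K) + 2·v_p ∏_ℓ c_ℓ(E) + 2·v_p(c)`. The logarithm is moved from `𝔭` to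
`𝔭′` by K1's `hasValueAt_sq_logOmega_embAt_iff_of_rank_one`; then §2 and K1's socket links
(`indexLowerBoundLeAt_of_imcLowerLe_of_control`, `Upper.indexUpperBoundLeAt_of_imcUpperLe_of_control`).
[cite: JetchevSkinnerWan2017, §7.4.1 (arXiv:1512.06894 p. 30)] [cite: Castella2018, Thm. 2.3 and §5 (arXiv:1704.06608 pp. 5, 12)] -/
theorem exactIndex_of_equality_of_value_of_control (hN : W.conductorNorm ℤ = N)
    (hK : IsImaginaryQuadratic K) (hHe : SatisfiesHeegnerHypothesis N K)
    (hrk : (W.baseChange K).mordellWeilRank = 1) (hfin : (W.baseChange K).ShaFinite)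
    {𝔭 𝔭' : HeightOneSpectrum (𝓞 K)} (h𝔭 : ((p : ℕ) : 𝓞 K) ∈ 𝔭.asIdeal)
    (he : 𝔭.asIdeal.ramificationIdx (𝓞 ℚ) = 1) (hf : 𝔭.asIdeal.inertiaDeg (𝓞 ℚ) = 1)
    (h𝔭' : ((p : ℕ) : 𝓞 K) ∈ 𝔭'.asIdeal)
    (he' : 𝔭'.asIdeal.ramificationIdx (𝓞 ℚ) = 1) (hf' : 𝔭'.asIdeal.inertiaDeg (𝓞 ℚ) = 1)
    {L : UnrSeries p}
    (h3 : (XAc.charIdeal (W.baseChange K) p κ 𝔭' ∅ γ).map (PowerSeries.map (toUnr p)) =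
      Ideal.span {L})
    (u : (unrIntegers p)ˣ) (c : ℤ)
    (h2 : L.HasValueAt 0 (((u : unrIntegers p) : ℂ_[p]) *
      (algebraMap ℚ_[p] ℂ_[p] (logOmega W p (embAt K p 𝔭 h𝔭 he hf) P / (c : ℚ_[p]))) ^ 2))
    (hC : AdditiveControlOnTreeAt p κ 𝔭' γ (embAt K p 𝔭' h𝔭' he' hf') P) :
    IndexLowerBoundLeAt W p K P (padicValNat p c.natAbs) ∧
      Upper.IndexUpperBoundLeAt W p K P (padicValNat p c.natAbs) := by
  obtain ⟨n, hn, _⟩ := id hC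
  have h2' : L.HasValueAt 0 (((u : unrIntegers p) : ℂ_[p]) *
      (algebraMap ℚ_[p] ℂ_[p] (logOmega W p (embAt K p 𝔭' h𝔭' he' hf') P / (c : ℚ_[p]))) ^ 2) :=
    (SchneiderFreeAdditiveX3.hasValueAt_sq_logOmega_embAt_iff_of_rank_one W p hK.1 hrk h𝔭 he hf
      h𝔭' he' hf' P ((u : unrIntegers p) : ℂ_[p]) (c : ℚ_[p]) L).mpr h2
  obtain ⟨hlow, hup⟩ := additiveIMC_lower_and_upper_of_value_of_eq hn h3 u c h2'
  exact ⟨SchneiderFreeAdditiveX3.indexLowerBoundLeAt_of_imcLowerLe_of_control hN hK hHe hfin hlow hC,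
    Upper.indexUpperBoundLeAt_of_imcUpperLe_of_control hN hK hHe hfin hup hC⟩

end Datum

end Summit.BirchSwinnertonDyer.BirchSwinnertonDyer.Theorems.SchneiderFree.Exact

end
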